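import Literature.Computability.AlgebraicComplexity.MS21ANFThm35OfStructureLemma
import Literature.Computability.AlgebraicComplexity.MS21ANFMonomialInclusion
import HarnessLib

/-!
# Medini–Shpilka 2021, Thm 35 (`thm:pitRoanf`): PROVED for fields of characteristic `0` or
# `> 2^{max Δ}`; all fields modulo the structure lemma only

With seat p1 g5's Lemma 5.12 in the tree (`MS2021.anf_rigidity_of_support_subset`,
`MS21ANFMonomialInclusion`: "if `mon(ANF_Δ(Ax + b)) ⊆ mon(ANF_Δ)` then `b = 0` and
`ANF_Δ(Ax) = ANF_Δ(α • x ∘ π)`") the hypothesis `h512` of the assemblies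
(`MS21ANFThm35OfMonomialInclusion`, `MS21ANFThm35OfStructureLemma`) is DISCHARGED
(`MS2021.h512_holds`).  Hence:

* **`MS2021_thm_35_of_cast_ne_zero`** — the typed statement of [MS21, Thm 35] at every
  `(K, n, Δ₁, Δ₂, c)` such that `1, 2, …, 2^{max Δ₁ Δ₂}` are nonzero in `K`: for
  `f₁ ∈ ANF_{Δ₁}^{GLaff_n(K)}`, `f₂ ∈ ANF_{Δ₂}^{GLaff_n(K)}` with `f₁ - f₂ ≠ 0`, every uniform
  `(2·max{Δ₁,Δ₂}+7)`-independent `G` satisfies `(f₁ - f₂) ∘ G ≠ 0`; instances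
  **`MS2021_thm_35_charZero`** (every field of characteristic `0` — the typed `MS2021_thm_35` with
  one extra binder `[CharZero K]`) and **`MS2021_thm_35_of_lt_ringChar`** (`char K > 2^{max Δ₁ Δ₂}`).
  Route = the printed one (§5.2: Lemmas 5.12–5.15, Cor 5.10, Claim pitRoanfSame, Thm 33), run on
  the affine polynomial graded by the uniform map instead of on its homogenisation (route of
  record, `MS21ANFOrbitsDistinctDepthProofs`), with Lemma 5.13 as printed — which needs
  `e(e-1) ≠ 0` in `K` for `e ≤ 2^Δ` (registry B36: the printed lemma is false in characteristic `2`).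
* **`MS2021_thm_35_of_structureLemma`** — the typed `MS2021_thm_35` for ALL fields from the single
  remaining hypothesis `hstruct`, the characteristic-free structure lemma for `ANF_Δ ∘ M`
  (seat t18 g5's B36 blueprint, stages S3–S4 in flight; S1, S2, S5 in the tree).

Theorems only (no definitions, no new named facts, D-0026).  HONEST FRAMING: `MS2021_thm_35` itself
(all fields, as typed) is NOT discharged here — only its restriction to characteristic `0` /
`> 2^{max Δ}`, by name, and its reduction to `hstruct`.  `VP ≠ VNP` is NOT proved and nothing in
this file bears on it.

## References
* [MediniShpilka2021] D. Medini, A. Shpilka, *Hitting sets and reconstruction for dense orbits in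
  VP_e and ΣΠΣ circuits*, CCC 2021 (LIPIcs 200:19) = arXiv:2102.05632: Thm 35 / ‹thm:pitRoanf›
  (CCC p.19:13; arXiv p0008:L29–30), proof §5.2 (p0030:L28–p0031:L24), Lemmas 5.12–5.15
  (p0027:L32–p0030:L26), Cor 5.10, Thm 33.
-/

noncomputable section

open MvPolynomial
open scoped Matrix

namespace Literature.Computability.AlgebraicComplexity

namespace MS2021

/-- **Lemma 5.12 in the `h512` shape of the core assemblies** (seat p1 g5's
`anf_rigidity_of_support_subset` with `b = 0`). [cite: MediniShpilka2021, Lemma 5.12 (arXiv p0027:L40-L43)] -/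
theorem h512_holds (K : Type) [Field K] (Δ : ℕ) :
    ∀ (M : Matrix (Fin (4 ^ Δ)) (Fin (4 ^ Δ)) K), IsUnit M.det →
      (affSubst le_rfl M 0 (anf K Δ)).support ⊆ (anf K Δ).support →
      ∃ (π : Equiv.Perm (Fin (4 ^ Δ))) (α : Fin (4 ^ Δ) → K), (∀ i, α i ≠ 0) ∧
        rename π (anf K Δ) = anf K Δ ∧
        affSubst le_rfl M 0 (anf K Δ) = aeval (fun i => C (α i) * X (π i)) (anf K Δ) :=
  fun _ hM hsub => (anf_rigidity_of_support_subset Δ hM 0 hsub).2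

end MS2021

open MS2021

/-- **MS Thm 35 (typed form) whenever `1, …, 2^{max Δ₁ Δ₂}` are nonzero in `K`.**
[cite: MediniShpilka2021, Thm 35 (CCC p.19:13; arXiv ‹pitSumOfRoanfThm› p0008:L29-30); proof §5.2 (arXiv p0030:L28–p0031:L24)] -/
theorem MS2021_thm_35_of_cast_ne_zero (K : Type) [Field K] (n Δ₁ Δ₂ c : ℕ)
    (hK : ∀ m : ℕ, 1 ≤ m → m ≤ 2 ^ max Δ₁ Δ₂ → (m : K) ≠ 0) :
    ∀ f₁ ∈ affOrbit n (anf K Δ₁), ∀ f₂ ∈ affOrbit n (anf K Δ₂), f₁ - f₂ ≠ 0 →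
      ∀ G : Fin n → MvPolynomial (Fin (2 * max Δ₁ Δ₂ + 7) × (Fin c ⊕ Unit)) K,
        IsIndependent (2 * max Δ₁ Δ₂ + 7) G → IsUniform G → bind₁ G (f₁ - f₂) ≠ 0 := by
  by_cases hΔ : Δ₁ = Δ₂
  · subst hΔ
    have hK' : ∀ m : ℕ, 1 ≤ m → m ≤ 2 ^ Δ₁ → (m : K) ≠ 0 :=
      fun m h1 h2 => hK m h1 (by rwa [max_self])
    exact MS2021_thm_35_sameDepth_of_h512_of_cast_ne_zero K Δ₁ hK' (h512_holds K Δ₁) n c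
  · exact MS2021_thm_35_of_ne K n Δ₁ Δ₂ c hΔ

/-- **MS Thm 35 over every field of characteristic `0`** — the typed `MS2021_thm_35` with the one
extra binder `[CharZero K]`. [cite: MediniShpilka2021, Thm 35 (CCC p.19:13; arXiv p0008:L29-30)] -/
theorem MS2021_thm_35_charZero : ∀ (K : Type) [Field K] [CharZero K] (n Δ₁ Δ₂ c : ℕ),
    ∀ f₁ ∈ affOrbit n (anf K Δ₁), ∀ f₂ ∈ affOrbit n (anf K Δ₂), f₁ - f₂ ≠ 0 →
      ∀ G : Fin n → MvPolynomial (Fin (2 * max Δ₁ Δ₂ + 7) × (Fin c ⊕ Unit)) K,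
        IsIndependent (2 * max Δ₁ Δ₂ + 7) G → IsUniform G → bind₁ G (f₁ - f₂) ≠ 0 :=
  fun K _ _ n Δ₁ Δ₂ c => MS2021_thm_35_of_cast_ne_zero K n Δ₁ Δ₂ c
    (fun m hm _ => by exact_mod_cast (by omega : m ≠ 0))

/-- **MS Thm 35 in characteristic `> 2^{max Δ₁ Δ₂}`.** [cite: MediniShpilka2021, Thm 35 (CCC p.19:13; arXiv p0008:L29-30)] -/
theorem MS2021_thm_35_of_lt_ringChar (K : Type) [Field K] (n Δ₁ Δ₂ c : ℕ)
    (hp : 2 ^ max Δ₁ Δ₂ < ringChar K) :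
    ∀ f₁ ∈ affOrbit n (anf K Δ₁), ∀ f₂ ∈ affOrbit n (anf K Δ₂), f₁ - f₂ ≠ 0 →
      ∀ G : Fin n → MvPolynomial (Fin (2 * max Δ₁ Δ₂ + 7) × (Fin c ⊕ Unit)) K,
        IsIndependent (2 * max Δ₁ Δ₂ + 7) G → IsUniform G → bind₁ G (f₁ - f₂) ≠ 0 := by
  refine MS2021_thm_35_of_cast_ne_zero K n Δ₁ Δ₂ c (fun m hm hmle h0 => ?_)
  have hdvd := (ringChar.spec K m).1 h0
  have := Nat.le_of_dvd (by omega) hdvd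
  omega

/-- **MS Thm 35 (all fields, as typed) from the structure lemma alone.**  `hstruct` is the
characteristic-free replacement of Lemma 5.13 (registry B36), in the upstairs binder shape of the
B36 blueprint. [cite: MediniShpilka2021, Thm 35 (CCC p.19:13; arXiv p0008:L29-30); proof §5.2 (arXiv p0030:L28–p0031:L24)] -/
theorem MS2021_thm_35_of_structureLemma
    (hstruct : ∀ (K : Type) [Field K] (Δ : ℕ) (N : Matrix (Fin (4 ^ Δ)) (Fin (4 ^ Δ)) K),
      IsUnit N.det → (∀ j, hasseD 2 (fun a => N a j) (anf K Δ) = 0) →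
      (∀ j j', pderiv j (pderiv j' (anf K Δ)) = 0 →
        (∑ a, ∑ a', C (N a j * N a' j') * pderiv a (pderiv a' (anf K Δ))) = 0) →
      (affSubst le_rfl N 0 (anf K Δ)).support ⊆ (anf K Δ).support) :
    MS2021_thm_35 :=
  MS2021_thm_35_of_h512_hstruct (fun K _ Δ => h512_holds K Δ) hstruct

end Literature.Computability.AlgebraicComplexity

end
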